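import Literature.NumberTheory.Automorphic.RelNormOneTorusInfPart
import Literature.Topology.Algebra.CircleCharacterExtension
import Mathlib.Topology.Algebra.PontryaginDual
import HarnessLib

/-!
# Automorphic characters of `[U(1)_{L/L⁺}]` with prescribed archimedean type

Topic `NumberTheory/Automorphic`; namespace `Literature.NumberTheory.Automorphic`.

For a CM field `L` with maximal totally real subfield `L⁺` the automorphic quotient of the norm-one torus
`[U(1)] = U(1)(L⁺) \ U(1)(𝔸_{L⁺}) = relNormOneIdeles L⁺ L ⧸ relNormOneRat L⁺ L` (file `RelNormOneTorus`) is a compact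
abelian group, and its archimedean torus `U(1)(L⁺ ⊗ ℝ) = ∏_{w ∣ ∞} U(1) = relNormOneInfUnits L⁺ L` (file
`RelNormOneTorusArch`) maps to it by `cl : y ↦ [(y, 1)]` (`relNormOneInfToQuot`).  The ARCHIMEDEAN TYPE of a
continuous unitary character `χ` of `[U(1)]` is the family of integers `m = (m_w)_w` with
`χ (cl y) = ∏_w ι_w(y_w)^{m_w}` (`UnitaryLineChar.HasArchType`; the typed weights are `archWeightCircle` /
`archWeight`, § 1).
**Main theorem** (`exists_unitaryLineChar_hasArchType`, § 2): for EVERY `m : (w ∣ ∞) → ℤ` there is a continuous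
unitary character of `[U(1)]` of archimedean type `m`.

This is the existence of automorphic characters of an anisotropic torus with prescribed infinity type; for
`U(1)_{L/L⁺}` every type is admissible because `U(1)(L⁺) ∩ (U(1)(L⁺ ⊗ ℝ) × K')` is trivial for a small open `K'`
(file `RelNormOneTorusInfPart`, `exists_level_forall_mem_relNormOneRat_eq_one`), in contrast with `GL(1)`, where the
global units force the conditions of [cite: WeilBNT1967, Ch. VII §3].  Proof: the weight character of the level
subgroup `U(1)(𝔸) ∩ (L_∞ˣ · K')` kills its rational points, so the tree's divisible-target extension engine
(`Literature.Topology.Algebra.exists_circleChar_extension_trivialOn` + `continuous_of_eqOn_openSubgroup`, file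
`Topology/Algebra/CircleCharacterExtension`) produces a continuous character of `U(1)(𝔸)` trivial on `U(1)(L⁺)` with
the prescribed archimedean restriction, which descends to `[U(1)]`.

Everything is proved (Mathlib + tree); no named facts.  Port to the tree idele library of the HodgeCM publication
cell's `PerL34/UnitaryLineChars` § 3 + `SeesawTorus` § 1 (2026-08-18).

References: A. Weil, *Basic Number Theory* (1967), Ch. VII § 3 [cite: WeilBNT1967, Ch. VII §3].
-/

set_option autoImplicit false

noncomputable section

open _root_.Topology _root_.Set _root_.Function _root_.Filter
open scoped Pointwise
open NumberField IsDedekindDomain InfinitePlace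

namespace Literature.NumberTheory.Automorphic

open Literature.Topology.Algebra (exists_circleChar_extension_trivialOn continuous_of_eqOn_openSubgroup)

/-! ## § 1. Typed archimedean weights and the archimedean type of a character of `[U(1)]` -/

section ArchType

variable (L : Type) [Field L] [NumberField L] [IsCMField L]

/-- The character of `U(1)(L⁺ ⊗ ℝ) = ∏_{w ∣ ∞} U(1)` of archimedean type `m : (w ∣ ∞) → ℤ`, valued in the unit
circle: `y ↦ ∏_w ι_w(y_w)^{m_w}`. [folklore] -/
def archWeightCircle (m : InfinitePlace L → ℤ) : relNormOneInfUnits (maximalRealSubfield L) L →* Circle where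
  toFun y := ∏ w, (archPlaceChars L y w) ^ (m w)
  map_one' := by simp
  map_mul' a b := by
    simp only [map_mul, Pi.mul_apply, mul_zpow, Finset.prod_mul_distrib]

/-- Values of the typed weight. [folklore] -/
theorem archWeightCircle_apply (m : InfinitePlace L → ℤ) (y : relNormOneInfUnits (maximalRealSubfield L) L) :
    archWeightCircle L m y = ∏ w, (archPlaceChar L w y) ^ (m w) := rfl

/-- The typed weight is continuous. [folklore] -/
theorem continuous_archWeightCircle (m : InfinitePlace L → ℤ) : Continuous (archWeightCircle L m) := by
  change Continuous fun y => ∏ w, (archPlaceChars L y w) ^ (m w)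
  exact continuous_finsetProd _ fun w _ => ((continuous_apply w).comp (continuous_archPlaceChars L)).zpow (m w)

/-- **The typed archimedean weight** `archWeight L m : U(1)(L⁺ ⊗ ℝ) →* ℂ`, `y ↦ ∏_w ι_w(y_w)^{m_w}`. [folklore] -/
def archWeight (m : InfinitePlace L → ℤ) : relNormOneInfUnits (maximalRealSubfield L) L →* ℂ :=
  Circle.coeHom.comp (archWeightCircle L m)

/-- Values of `archWeight` (definitional). [folklore] -/
theorem archWeight_apply (m : InfinitePlace L → ℤ) (y : relNormOneInfUnits (maximalRealSubfield L) L) :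
    archWeight L m y = ((archWeightCircle L m y : Circle) : ℂ) := rfl

/-- `archWeight L m y = ∏_w ι_w(y_w)^{m_w}` in `ℂ`. [folklore] -/
theorem archWeight_eq_prod (m : InfinitePlace L → ℤ) (y : relNormOneInfUnits (maximalRealSubfield L) L) :
    archWeight L m y = ∏ w, ((archPlaceChar L w y : Circle) : ℂ) ^ (m w) := by
  rw [archWeight, MonoidHom.comp_apply, archWeightCircle_apply, map_prod]
  exact Finset.prod_congr rfl fun w _ => Circle.coe_zpow _ _

/-- The typed weight is unitary. [folklore] -/
theorem norm_archWeight (m : InfinitePlace L → ℤ) (y : relNormOneInfUnits (maximalRealSubfield L) L) :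
    ‖archWeight L m y‖ = 1 :=
  Circle.norm_coe _

/-- The typed weight is continuous (as a map to `ℂ`). [folklore] -/
theorem continuous_archWeight (m : InfinitePlace L → ℤ) : Continuous (archWeight L m) :=
  continuous_subtype_val.comp (continuous_archWeightCircle L m)

/-- Weight `0` is the trivial character. [folklore] -/
@[simp] theorem archWeight_zero (y : relNormOneInfUnits (maximalRealSubfield L) L) : archWeight L 0 y = 1 := by
  simp [archWeight_eq_prod]

/-- Weights add. [folklore] -/
theorem archWeight_add (m m' : InfinitePlace L → ℤ) (y : relNormOneInfUnits (maximalRealSubfield L) L) :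
    archWeight L (m + m') y = archWeight L m y * archWeight L m' y := by
  simp only [archWeight_eq_prod, Pi.add_apply, ← Finset.prod_mul_distrib]
  refine Finset.prod_congr rfl fun w _ => ?_
  rw [zpow_add₀ (Circle.coe_ne_zero _)]

end ArchType

section Quot

variable (K L : Type) [Field K] [Field L] [NumberField L] [Algebra K L] [FiniteDimensional K L]

/-- `cl : U(1)(K ⊗ ℝ) → [U(1)]`, the archimedean torus mapped to the automorphic quotient. [folklore] -/
def relNormOneInfToQuot : relNormOneInfUnits K L →* relNormOneIdeles K L ⧸ relNormOneRat K L :=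
  (QuotientGroup.mk' (relNormOneRat K L)).comp (relNormOneInfToIdeles K L)

/-- Values of `cl` (definitional). [folklore] -/
@[simp] theorem relNormOneInfToQuot_apply (y : relNormOneInfUnits K L) :
    relNormOneInfToQuot K L y = (QuotientGroup.mk (relNormOneInfToIdeles K L y) : _ ⧸ relNormOneRat K L) := rfl

/-- `cl` is continuous. [folklore] -/
theorem continuous_relNormOneInfToQuot : Continuous (relNormOneInfToQuot K L) :=
  QuotientGroup.continuous_mk.comp (continuous_relNormOneInfToIdeles K L)

end Quot

namespace UnitaryLineChar

variable (L : Type) [Field L] [NumberField L] [IsCMField L]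

/-- "`χ` has archimedean type `m`": `χ (cl y) = ∏_w ι_w(y_w)^{m_w}` for every `y ∈ U(1)(L⁺ ⊗ ℝ)`. [folklore] -/
def HasArchType (χ : ContinuousMonoidHom (relNormOneIdeles (maximalRealSubfield L) L ⧸
      relNormOneRat (maximalRealSubfield L) L) Circle) (m : InfinitePlace L → ℤ) : Prop :=
  ∀ y : relNormOneInfUnits (maximalRealSubfield L) L,
    χ (relNormOneInfToQuot (maximalRealSubfield L) L y) = archWeightCircle L m y

/-- The archimedean type read in `ℂ`. [folklore] -/
theorem hasArchType_iff (χ : ContinuousMonoidHom (relNormOneIdeles (maximalRealSubfield L) L ⧸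
      relNormOneRat (maximalRealSubfield L) L) Circle) (m : InfinitePlace L → ℤ) :
    HasArchType L χ m ↔ ∀ y : relNormOneInfUnits (maximalRealSubfield L) L,
      ((χ (relNormOneInfToQuot (maximalRealSubfield L) L y) : Circle) : ℂ) = archWeight L m y := by
  refine forall_congr' fun y => ?_
  rw [archWeight_apply]
  exact ⟨fun h => congrArg _ h, fun h => Circle.ext h⟩

/-- The trivial character has archimedean type `0`. [folklore] -/
theorem hasArchType_one : HasArchType L 1 0 := by
  intro y
  apply Circle.ext
  rw [← archWeight_apply, archWeight_zero]
  rfl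

/-- Archimedean types add under products of characters. [folklore] -/
theorem HasArchType.mul {χ χ' : ContinuousMonoidHom (relNormOneIdeles (maximalRealSubfield L) L ⧸
      relNormOneRat (maximalRealSubfield L) L) Circle} {m m' : InfinitePlace L → ℤ}
    (h : HasArchType L χ m) (h' : HasArchType L χ' m') : HasArchType L (χ * χ') (m + m') := by
  rw [hasArchType_iff] at h h' ⊢
  intro y
  rw [archWeight_add, ← h y, ← h' y]
  rfl

end UnitaryLineChar

/-! ## § 2. Characters of `[U(1)]` of every archimedean type -/

section Existence

variable (L : Type) [Field L] [NumberField L] [IsCMField L]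

local notation "L⁺" => maximalRealSubfield L

/-- The weight-`m` character `u ↦ ∏_w (u_∞)_w^{m_w}` of the level-`K'` subgroup `U(1)(𝔸) ∩ (L_∞ˣ · K')`.
[folklore] -/
def levelWeightChar (m : InfinitePlace L → ℤ) (K' : Subgroup (integralAdeles L)ˣ) :
    relNormOneLevel L L⁺ K' →* Circle :=
  (archWeightCircle L m).comp ((relNormOneInfPart L L⁺).comp (relNormOneLevel L L⁺ K').subtype)

/-- Values of the level weight character (definitional). [folklore] -/
theorem levelWeightChar_apply (m : InfinitePlace L → ℤ) (K' : Subgroup (integralAdeles L)ˣ)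
    (u : relNormOneLevel L L⁺ K') :
    levelWeightChar L m K' u = archWeightCircle L m (relNormOneInfPart L L⁺ (u : relNormOneIdeles L⁺ L)) := rfl

/-- The level weight character is continuous. [folklore] -/
theorem continuous_levelWeightChar (m : InfinitePlace L → ℤ) (K' : Subgroup (integralAdeles L)ˣ) :
    Continuous (levelWeightChar L m K') :=
  (continuous_archWeightCircle L m).comp ((continuous_relNormOneInfPart L L⁺).comp continuous_subtype_val)

/-- On the archimedean torus the level weight character is the typed weight. [folklore] -/
theorem levelWeightChar_relNormOneInfToIdeles (m : InfinitePlace L → ℤ) (K' : Subgroup (integralAdeles L)ˣ)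
    (y : relNormOneInfUnits L⁺ L) :
    levelWeightChar L m K' ⟨relNormOneInfToIdeles L⁺ L y, relNormOneInfToIdeles_mem_relNormOneLevel L L⁺ K' y⟩ =
      archWeightCircle L m y := by
  rw [levelWeightChar_apply]
  exact congrArg (archWeightCircle L m) (relNormOneInfPart_relNormOneInfToIdeles L L⁺ y)

/-- **A continuous character of `U(1)(𝔸_{L⁺})`, trivial on `U(1)(L⁺)`, restricting to the weight-`m` character on
the archimedean torus.** [cite: WeilBNT1967, Ch. VII §3] -/
theorem exists_continuousMonoidHom_relNormOneIdeles_archWeight (m : InfinitePlace L → ℤ) :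
    ∃ χ : ContinuousMonoidHom (relNormOneIdeles L⁺ L) Circle,
      relNormOneRat L⁺ L ≤ (χ : relNormOneIdeles L⁺ L →* Circle).ker ∧
        ∀ y : relNormOneInfUnits L⁺ L, χ (relNormOneInfToIdeles L⁺ L y) = archWeightCircle L m y := by
  obtain ⟨K', hK'⟩ := exists_level_forall_mem_relNormOneRat_eq_one L L⁺
  set H : Subgroup (relNormOneIdeles L⁺ L) := relNormOneLevel L L⁺ (K' : Subgroup (integralAdeles L)ˣ) with hH
  have hψ : ∀ u : H, (u : relNormOneIdeles L⁺ L) ∈ relNormOneRat L⁺ L → levelWeightChar L m K' u = 1 := by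
    intro u hu
    have h1 : (u : relNormOneIdeles L⁺ L) = 1 := hK' u u.2 hu
    have h1' : u = 1 := Subtype.ext h1
    rw [h1', map_one]
  obtain ⟨χ', hΓ, hext⟩ :=
    exists_circleChar_extension_trivialOn H (relNormOneRat L⁺ L) (levelWeightChar L m K') hψ
  have hcont : Continuous χ' :=
    continuous_of_eqOn_openSubgroup H (isOpen_relNormOneLevel L L⁺ K') (levelWeightChar L m K')
      (continuous_levelWeightChar L m K') χ' hext
  refine ⟨{ χ' with continuous_toFun := hcont }, fun γ hγ => (MonoidHom.mem_ker).mpr (hΓ γ hγ), fun y => ?_⟩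
  rw [← levelWeightChar_relNormOneInfToIdeles L m (K' : Subgroup (integralAdeles L)ˣ) y, ← hext]
  rfl

/-- **Characters of `[U(1)]` of every archimedean type.**  For every `m : {infinite places of L} → ℤ` there is a
continuous unitary character `χ` of `[U(1)] = U(1)(L⁺) \ U(1)(𝔸_{L⁺})` with `χ (cl y) = ∏_w ι_w(y_w)^{m_w}` on the
archimedean torus. [cite: WeilBNT1967, Ch. VII §3] -/
theorem exists_unitaryLineChar_hasArchType (m : InfinitePlace L → ℤ) :
    ∃ χ : ContinuousMonoidHom (relNormOneIdeles L⁺ L ⧸ relNormOneRat L⁺ L) Circle,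
      UnitaryLineChar.HasArchType L χ m := by
  obtain ⟨χ, hker, hχ⟩ := exists_continuousMonoidHom_relNormOneIdeles_archWeight L m
  -- descend to the quotient
  let χq : (relNormOneIdeles L⁺ L ⧸ relNormOneRat L⁺ L) →* Circle :=
    QuotientGroup.lift (relNormOneRat L⁺ L) (χ : relNormOneIdeles L⁺ L →* Circle) hker
  have hχq : ∀ u : relNormOneIdeles L⁺ L, χq (QuotientGroup.mk u) = χ u := fun u => rfl
  have hcomp : (χq : _ → Circle) ∘ (QuotientGroup.mk : relNormOneIdeles L⁺ L → _) = χ := funext hχq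
  have hχq_cont : Continuous χq := by
    rw [← QuotientGroup.isOpenQuotientMap_mk.continuous_comp_iff, hcomp]
    exact χ.continuous
  refine ⟨{ toMonoidHom := χq, continuous_toFun := hχq_cont }, fun y => ?_⟩
  rw [← hχ y]
  rfl

/-- The set of archimedean types realised by characters of `[U(1)]` is all of `ℤ^{places}` (restatement).
[cite: WeilBNT1967, Ch. VII §3] -/
theorem forall_archType_exists_unitaryLineChar :
    ∀ m : InfinitePlace L → ℤ,
      ∃ χ : ContinuousMonoidHom (relNormOneIdeles L⁺ L ⧸ relNormOneRat L⁺ L) Circle,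
        UnitaryLineChar.HasArchType L χ m :=
  exists_unitaryLineChar_hasArchType L

end Existence

end Literature.NumberTheory.Automorphic

end
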